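import Mathlib.MeasureTheory.Integral.IntegralEqImproper
import Mathlib.Analysis.SpecialFunctions.Gaussian.GaussianIntegral
import Mathlib.Analysis.SpecialFunctions.ExpDeriv
import HarnessLib

/-!
# The one-variable Stein / Schwinger–Dyson identity on the real line, and the free-field site law

HONEST FRAMING: exact (Metropolis-corrected) sampling algorithms for lattice gauge theory;
figures of merit are autocorrelation/cost numbers at stated couplings and volumes; no
continuum-physics claim.

Venture `LatticeQCDFlow` (cell pub-lqcd), sub-topic `Exactness`; FANOUT row 9 (`eng-latcore`).  NEW
WORK of the cell (own statement and proof).  Companion of `Exactness/SteinCircle.lean` (the periodic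
case): here the variable ranges over `ℝ` — the situation of ONE site of the lattice φ⁴ field given
its neighbours, whose conditional law is `∝ e^{−S(φ)}`, `S(φ) = λφ⁴ + (4 + m²)φ² − 2nφ` (AKS2019
normalisation; `n` = the neighbour sum).  `latflow.core.schwinger_dyson.residual_phi4_2d` (0.2.5)
writes the VIRIAL residual `1 − φ ∂S/∂φ` and the SCORE residual `∂²S/∂φ² − (∂S/∂φ)²` per site; both
have mean zero under the joint law because the one-variable identity below holds for every
configuration of the other sites.

* **`stein_real_line`** — for differentiable `S`, `h` with `h · e^{−S}` AND `(h′ − S′ h) e^{−S}`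
  integrable on `ℝ`: `∫ (h′ x − S′ x · h x) e^{−S x} dx = 0` (Mathlib's whole-line FTC
  `integral_eq_zero_of_hasDerivAt_of_integrable`; integrability replaces the periodic boundary
  condition of the circle case);
* **`gaussian_virial`** — the free-field (`λ = 0`) site law in its centred form `e^{−b x²}`, `b > 0`:
  `∫ (1 − 2b x²) e^{−b x²} dx = 0`, i.e. `⟨x ∂S/∂x⟩ = 1` (equipartition; the `λ = 0` anchor of the
  engine's virial column);
* **`gaussian_score`** — `∫ (2b − 4b² x²) e^{−b x²} dx = 0`, i.e. `⟨S″⟩ = ⟨(S′)²⟩` for the same law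
  (the `λ = 0` anchor of the score column).

Not typed here: the interacting (`λ > 0`) site law (needs the integrability of polynomial ×
`e^{−λx⁴ − bx² + cx}`, true but not a one-liner), the product-measure statement, and power.
-/

namespace Summit.Ventures.LatticeQCDFlow.Exactness

open Real MeasureTheory

/-- **Stein's identity on the real line.**  If `S` and `h` are differentiable everywhere with
derivatives `S′`, `h′`, and both `x ↦ h x · e^{−S x}` and the Stein integrand
`x ↦ (h′ x − S′ x · h x) · e^{−S x}` are integrable on `ℝ`, then `∫ (h′ − S′ h) e^{−S} = 0`. -/
theorem stein_real_line {S S' h h' : ℝ → ℝ}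
    (hS : ∀ x, HasDerivAt S (S' x) x) (hh : ∀ x, HasDerivAt h (h' x) x)
    (hf : Integrable (fun x => h x * Real.exp (-S x)))
    (hint : Integrable (fun x => (h' x - S' x * h x) * Real.exp (-S x))) :
    ∫ x, (h' x - S' x * h x) * Real.exp (-S x) = 0 := by
  refine integral_eq_zero_of_hasDerivAt_of_integrable (f := fun x => h x * Real.exp (-S x)) ?_ hint hf
  intro x
  have h1 : HasDerivAt (fun y => -S y) (-S' x) x := (hS x).neg
  have h2 : HasDerivAt (fun y => Real.exp (-S y)) (Real.exp (-S x) * (-S' x)) x := h1.exp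
  have h3 := (hh x).mul h2
  have heq : (h' x - S' x * h x) * Real.exp (-S x)
      = h' x * Real.exp (-S x) + h x * (Real.exp (-S x) * -S' x) := by ring
  rw [heq]
  exact h3

/-- `x ↦ x² e^{−b x²}` is integrable for `b > 0` (from Mathlib's `rpow` version). -/
theorem integrable_sq_mul_exp_neg_mul_sq {b : ℝ} (hb : 0 < b) :
    Integrable (fun x : ℝ => x ^ 2 * Real.exp (-b * x ^ 2)) := by
  have h := integrable_rpow_mul_exp_neg_mul_sq hb (s := 2) (by norm_num)
  refine h.congr ?_
  filter_upwards with x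
  rw [Real.rpow_two]

/-- **The free-field site law: virial identity (equipartition).**  For `b > 0`:
`∫ (1 − 2b x²) e^{−b x²} dx = 0`, i.e. `⟨x · S′(x)⟩ = 1` for `S(x) = b x²`. -/
theorem gaussian_virial {b : ℝ} (hb : 0 < b) :
    ∫ x : ℝ, (1 - 2 * b * x ^ 2) * Real.exp (-b * x ^ 2) = 0 := by
  have hS : ∀ x : ℝ, HasDerivAt (fun y => b * y ^ 2) (2 * b * x) x := by
    intro x
    have h := ((hasDerivAt_id x).pow 2).const_mul b
    simpa [mul_comm, mul_assoc, mul_left_comm] using h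
  have hh : ∀ x : ℝ, HasDerivAt (fun y : ℝ => y) 1 x := fun x => hasDerivAt_id x
  have hf : Integrable (fun x : ℝ => x * Real.exp (-(b * x ^ 2))) := by
    have h := integrable_mul_exp_neg_mul_sq hb
    refine h.congr ?_
    filter_upwards with x; rw [neg_mul]
  have hint : Integrable (fun x : ℝ => (1 - 2 * b * x * x) * Real.exp (-(b * x ^ 2))) := by
    have h1 := integrable_exp_neg_mul_sq hb
    have h2 := (integrable_sq_mul_exp_neg_mul_sq hb).const_mul (2 * b)
    refine (h1.sub h2).congr ?_
    filter_upwards with x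
    simp only [Pi.sub_apply, neg_mul]
    ring
  have hmain := stein_real_line (S := fun y => b * y ^ 2) (S' := fun x => 2 * b * x) (h := fun y => y)
    (h' := fun _ => 1) hS hh hf hint
  have hpt : (fun x : ℝ => (1 - 2 * b * x ^ 2) * Real.exp (-b * x ^ 2))
      = fun x => (1 - 2 * b * x * x) * Real.exp (-(b * x ^ 2)) := by
    funext x; rw [neg_mul]; ring
  rw [hpt]; exact hmain

/-- **The free-field site law: score identity.**  For `b > 0`:
`∫ (2b − 4b² x²) e^{−b x²} dx = 0`, i.e. `⟨S″⟩ = ⟨(S′)²⟩` for `S(x) = b x²` (test function `h = S′`). -/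
theorem gaussian_score {b : ℝ} (hb : 0 < b) :
    ∫ x : ℝ, (2 * b - 4 * b ^ 2 * x ^ 2) * Real.exp (-b * x ^ 2) = 0 := by
  have hS : ∀ x : ℝ, HasDerivAt (fun y => b * y ^ 2) (2 * b * x) x := by
    intro x
    have h := ((hasDerivAt_id x).pow 2).const_mul b
    simpa [mul_comm, mul_assoc, mul_left_comm] using h
  have hh : ∀ x : ℝ, HasDerivAt (fun y : ℝ => 2 * b * y) (2 * b) x := by
    intro x
    simpa using (hasDerivAt_id x).const_mul (2 * b)
  have hf : Integrable (fun x : ℝ => 2 * b * x * Real.exp (-(b * x ^ 2))) := by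
    have h := (integrable_mul_exp_neg_mul_sq hb).const_mul (2 * b)
    refine h.congr ?_
    filter_upwards with x
    simp only [neg_mul]
    ring
  have hint : Integrable (fun x : ℝ => (2 * b - 2 * b * x * (2 * b * x)) * Real.exp (-(b * x ^ 2))) := by
    have h1 := (integrable_exp_neg_mul_sq hb).const_mul (2 * b)
    have h2 := (integrable_sq_mul_exp_neg_mul_sq hb).const_mul (4 * b ^ 2)
    refine (h1.sub h2).congr ?_
    filter_upwards with x
    simp only [Pi.sub_apply, neg_mul]
    ring
  have hmain := stein_real_line (S := fun y => b * y ^ 2) (S' := fun x => 2 * b * x)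
    (h := fun y => 2 * b * y) (h' := fun _ => 2 * b) hS hh hf hint
  have hpt : (fun x : ℝ => (2 * b - 4 * b ^ 2 * x ^ 2) * Real.exp (-b * x ^ 2))
      = fun x => (2 * b - 2 * b * x * (2 * b * x)) * Real.exp (-(b * x ^ 2)) := by
    funext x; rw [neg_mul]; ring
  rw [hpt]; exact hmain

end Summit.Ventures.LatticeQCDFlow.Exactness
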